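import Summits.HubbardSuperconductivity.HubbardSuperconductivity.Theorems.FunctionFieldCertificateCertificateSoundness
import Summits.HubbardSuperconductivity.HubbardSuperconductivity.Theorems.FunctionFieldCertificateWindowInfraredBoundReductions
import Literature.MathematicalPhysics.QuantumLattice.PairFieldMomentum
import Literature.MathematicalPhysics.QuantumLattice.HubbardHubbardModel
import Literature.MathematicalPhysics.QuantumLattice.ApproximateEigenvectorLemmas

/-!
# Sketch (ideator 4, round 2) — crux `WindowInfraredBound` (stmt-HubbardSuperconductivity-1089)
# idea `kkt-pencil-multiplier-bootstrap`: first lemmas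

* `windowOp L ε` — the window operator `W_ε = Σ_{m ≠ 0, |q_m|² ≤ ε²} L⁻² Δ_d(m)ᴴ Δ_d(m)` (KacWindowPenalty's
  Kac window without its `m = 0` mode), so that `T_ε(ψ) = Re ⟨ψ, W_ε ψ⟩` for the crux's window tail.
* `WindowCertificateAt L U δ C ε` — an EVALUATED window certificate at one `L`: the operator identity
  `CεL²·1 − W_ε = Σ Oᵢᴴ Oᵢ + Σ Qᵢᴴ (H Qᵢ − Qᵢ H) + (H R − R H) + T` with sector-preserving `Qᵢ` and a
  sector term `T` (the exact shape of `CertifiedSectorLRO`, with `L⁻⁴Δ_dᴴΔ_d − (a − C/L)` replaced by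
  `CεL² − W_ε`): what evaluating a level-`k` momentum-space KKT/SOS dual solution at the `L`-th roots of
  unity produces.
* `WindowCertificateFamily` — the TRANSFER `C⁺`: such certificates exist eventually in even `L`, uniformly
  in `ε ≤ ε₀`, at every `(U, δ)` (strictly stronger than the crux by `CertificateCompleteness`-type
  reasoning only when the level is unbounded; at bounded level it is the route's pole-half bet).
* `wib_of_windowCertificateFamily` — soundness: `C⁺ → WindowInfraredBound` (provable now from the landed
  `re_expect_certificate_nonneg`; left `sorry` here — it is the line's bookkeeping stub, not its content).
* `energyForm_pencil` — the 2×2 KKT PENCIL (Cauchy–Schwarz for the positive form `X, Y ↦ ⟨Xψ,(H − E₀)Yψ⟩`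
  on the sector at a sector ground state): the inequality through which a level-`k` relaxation can turn an
  exact commutator identity `[H, B] = κ·A + …` into an UPPER bound on `‖Aψ‖²` (for quadratic `H` it IS
  Gaussian domination, cf. the card's toy check); provable now, left `sorry`.

Idea 2 (`annihilator-eom-pole-one`), second section of the file:
* `etaAt`, `piPiLabel` — the on-site pair field at a momentum label and the `(π,π)` label;
* `etaWindowBound` — the η-WINDOW BOUND on `hubbardTorus 2 L 1 U` (RP-free, T = 0, every sector ground state;
  signature, provable now from the tree's Yang commutators; `sorry` here);
* `eucNorm_mulVec_le_of_approxLowering` — THE LEVER of idea 2, PROVED: `(ω − (E − E'))‖Bψ‖₂ ≤ ‖([H,B] + ωB)ψ‖₂`.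
-/

noncomputable section

namespace Summit.HubbardSuperconductivity.HubbardSuperconductivity.Cruxes.WindowInfraredBound.Ideator4

open Matrix Finset Literature.MathematicalPhysics.QuantumLattice Literature.Probability.LatticeModels
open scoped ComplexOrder

variable (L : ℕ) [NeZero L]

/-- The window operator `W_ε = Σ_{m ≠ 0, momentumNormSq L m ≤ ε²} L⁻² Δ_d(m)ᴴ Δ_d(m)`. [cite: KLS1988PRL, p. 2582] -/
def windowOp (ε : ℝ) :
    Matrix (Finset (Orb (FermionTorus 2 L))) (Finset (Orb (FermionTorus 2 L))) ℂ :=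
  ∑ m : TorusSite 2 L, if m ≠ 0 ∧ momentumNormSq L m ≤ ε ^ 2 then
    (1 / (L : ℂ) ^ 2) • ((pairFieldAt dWaveFormFactor L m)ᴴ * pairFieldAt dWaveFormFactor L m) else 0

/-- An evaluated WINDOW CERTIFICATE at `(U, δ, C, ε)` on the torus of side `L`: the semantic shadow of a
level-`k` momentum-space KKT/SOS dual solution for the functional `CεL² − W_ε`. [cite: WangEtAl2024] -/
def WindowCertificateAt (U δ C ε : ℝ) : Prop :=
  ∃ (n k : ℕ) (O : Fin n → Matrix (Finset (Orb (FermionTorus 2 L))) (Finset (Orb (FermionTorus 2 L))) ℂ)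
    (Q : Fin k → Matrix (Finset (Orb (FermionTorus 2 L))) (Finset (Orb (FermionTorus 2 L))) ℂ)
    (R T : Matrix (Finset (Orb (FermionTorus 2 L))) (Finset (Orb (FermionTorus 2 L))) ℂ),
    (∀ (i : Fin k) (φ : Fock (Orb (FermionTorus 2 L))),
        φ ∈ szSector (Λ := FermionTorus 2 L) (2 * ⌊(1 - δ) * (L : ℝ) ^ 2 / 2⌋₊) 0 →
          Q i *ᵥ φ ∈ szSector (Λ := FermionTorus 2 L) (2 * ⌊(1 - δ) * (L : ℝ) ^ 2 / 2⌋₊) 0) ∧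
    (∀ φ : Fock (Orb (FermionTorus 2 L)),
        φ ∈ szSector (Λ := FermionTorus 2 L) (2 * ⌊(1 - δ) * (L : ℝ) ^ 2 / 2⌋₊) 0 →
          star φ ⬝ᵥ T *ᵥ φ = 0) ∧
    ((C * ε * (L : ℝ) ^ 2 : ℝ) : ℂ) • (1 : Matrix (Finset (Orb (FermionTorus 2 L))) (Finset (Orb (FermionTorus 2 L))) ℂ)
        - windowOp L ε =
      ∑ i, (O i)ᴴ * O i +
        ∑ i, (Q i)ᴴ * (hubbardTorus 2 L 1 U * Q i - Q i * hubbardTorus 2 L 1 U) +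
        (hubbardTorus 2 L 1 U * R - R * hubbardTorus 2 L 1 U) + T

/-- The transfer `C⁺`: window certificates exist eventually in even `L`, uniformly in `ε ≤ ε₀`, at every
`(U, δ)`. [cite: WangEtAl2024] -/
def WindowCertificateFamily : Prop :=
  ∀ U : ℝ, 0 < U → ∀ δ ∈ Set.Ioo (0:ℝ) (1 / 2), ∃ C ε₀ : ℝ, 0 ≤ C ∧ 0 < ε₀ ∧ ∃ L₀ : ℕ,
    ∀ ε ∈ Set.Ioc (0:ℝ) ε₀, ∀ (L : ℕ) [NeZero L], L₀ ≤ L → Even L → WindowCertificateAt L U δ C ε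

/-- `Re ⟨ψ, W_ε ψ⟩ = T_ε(ψ)`: the window operator's expectation is the crux's window tail. [folklore] -/
theorem re_expect_windowOp (ε : ℝ) (ψ : Fock (Orb (FermionTorus 2 L))) :
    (star ψ ⬝ᵥ windowOp L ε *ᵥ ψ).re =
      ∑ m : TorusSite 2 L, if m ≠ 0 ∧ momentumNormSq L m ≤ ε ^ 2 then
        pairStructureFactor dWaveFormFactor L ψ m else 0 := by
  simp only [windowOp, sum_mulVec, dotProduct_sum, Complex.re_sum]
  refine Finset.sum_congr rfl fun m _ => ?_
  split_ifs with hm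
  · rw [smul_mulVec, dotProduct_smul, ← star_mulVec_dotProduct_mulVec, pairStructureFactor_apply,
      smul_eq_mul, show (1 / (L : ℂ) ^ 2) = (((1 / (L : ℝ) ^ 2 : ℝ)) : ℂ) by push_cast; rfl,
      Complex.re_ofReal_mul]
    ring
  · rw [zero_mulVec, dotProduct_zero, Complex.zero_re]

/-- **Soundness of window certificates** (first lemma of the line, PROVED from the landed
`re_expect_certificate_nonneg`): `C⁺ → WindowInfraredBound`. [folklore] -/
theorem wib_of_windowCertificateFamily (h : WindowCertificateFamily) :
    Summit.HubbardSuperconductivity.HubbardSuperconductivity.Theses.FunctionFieldCertificate.WindowInfraredBound := by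
  rw [Theorems.wib_iff_pairStructureFactor]
  intro U hU δ hδ
  obtain ⟨C, ε₀, hC, hε₀, L₀, hfam⟩ := h U hU δ hδ
  refine ⟨C, ε₀, hC, hε₀, L₀, fun ε hε L _ hL hev ψ hψ1 hgs => ?_⟩
  obtain ⟨n, k, O, Q, R, T, hQ, hT, hId⟩ := hfam ε hε L hL hev
  have hH : (hubbardTorus 2 L 1 U).IsHermitian := LiebThm1.hamiltonian_isHermitian _ 1 U
  obtain ⟨hψK, -, hHψ⟩ := hgs
  have h0 := Theorems.re_expect_certificate_nonneg hH _ O Q R T hQ hT hψK hHψ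
  rw [← hId, sub_mulVec, dotProduct_sub, Complex.sub_re, smul_mulVec, one_mulVec, dotProduct_smul,
    hψ1, smul_eq_mul, mul_one, Complex.ofReal_re, re_expect_windowOp] at h0
  linarith

/-- **The KKT pencil** (energy-form Cauchy–Schwarz): at a sector ground state `ψ` of a Hermitian `H`
(`H ψ = E₀ ψ`, `E₀ = minEnergyOn H K`), for operators `A, B` mapping `ψ` into the sector `K`,
`|⟨Aψ, (H − E₀) Bψ⟩|² ≤ ⟨Aψ,(H − E₀)Aψ⟩ · ⟨Bψ,(H − E₀)Bψ⟩` — positivity of the level-2 KKT block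
`[[⟨Aᴴ[H,A]⟩, ⟨Aᴴ[H,B]⟩],[⟨Bᴴ[H,A]⟩, ⟨Bᴴ[H,B]⟩]] ⪰ 0`. [folklore] -/
theorem energyForm_pencil {ι : Type*} [Fintype ι] [DecidableEq ι] {H : Matrix ι ι ℂ}
    (hH : H.IsHermitian) (K : Submodule ℂ (ι → ℂ)) (A B : Matrix ι ι ℂ) {ψ : ι → ℂ}
    (hA : A *ᵥ ψ ∈ K) (hB : B *ᵥ ψ ∈ K)
    (hHψ : H *ᵥ ψ = ((H.minEnergyOn K : ℝ) : ℂ) • ψ) :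
    ‖star (A *ᵥ ψ) ⬝ᵥ (H *ᵥ (B *ᵥ ψ) - ((H.minEnergyOn K : ℝ) : ℂ) • (B *ᵥ ψ))‖ ^ 2 ≤
      (star (A *ᵥ ψ) ⬝ᵥ (H *ᵥ (A *ᵥ ψ) - ((H.minEnergyOn K : ℝ) : ℂ) • (A *ᵥ ψ))).re *
        (star (B *ᵥ ψ) ⬝ᵥ (H *ᵥ (B *ᵥ ψ) - ((H.minEnergyOn K : ℝ) : ℂ) • (B *ᵥ ψ))).re := by
  sorry


/-! ## Idea 2 (`annihilator-eom-pole-one`): one-sided KKT with a LOWERING EIGENOPERATOR — the exact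
`η`-channel instance on the summit's matrix (RP-free `T = 0` window bound), and the `d`-wave split -/

/-- The on-site (`s`-wave) pair field at momentum label `p`: `η(p) = Σ_x e^{-2πi p·x/L} c_{x↓} c_{x↑}`
(same phase convention as `pairFieldAt`). Yang, PRL 63 (1989) 2144, eq. (4). [cite: Yang1989, eq. (4)] -/
def etaAt (p : TorusSite 2 L) :
    Matrix (Finset (Orb (FermionTorus 2 L))) (Finset (Orb (FermionTorus 2 L))) ℂ :=
  ∑ x : Fin 2 → ZMod L,
    Complex.exp (-(2 * Real.pi * Complex.I * (((∑ i : Fin 2, p i * x i).val : ℕ) : ℂ) / (L : ℂ))) •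
      onSitePair (d := 2) x

/-- The corner label `(L/2, L/2)`, i.e. the momentum `Q = (π, π)` when `L` is even. [folklore] -/
def piPiLabel : TorusSite 2 L := fun _ => ((L / 2 : ℕ) : ZMod L)

/-- **`η`-WINDOW BOUND** (calibration theorem of idea 2; provable now from the tree's Yang commutators
`hopTerm_commutator_etaRaise` / `interaction_commutator_etaRaise`, the variational principle in the
`(N_L − 2, 0)` sector and the operator Plancherel `sum_conjTranspose_mul_fourierMode`): in every normalised
`(N_L, 0)`-sector ground state of the pure (`t' = 0`) repulsive Hubbard torus of even side, IF the pair-removal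
energy is below `U` (`E(N_L) − E(N_L − 2) < U`, i.e. the `η`-mode is gapped, `U − 2μ₋ > 0`), THEN the on-site pair
structure factor in the punctured window around `Q = (π,π)` obeys the FLAT window law
`Σ_{0 < |q| ≤ ε} L⁻² ‖η(Q+q)ψ‖² ≤ 8 ε² L² / (U − (E(N_L) − E(N_L−2)))²` — one KKT inequality with the lowering
eigenoperator `η(Q+q)` (`[H, η(Q+q)] = −U η(Q+q) − G_q`, `G_q = Σ_e (1 − e^{-iq·e}) B_e(Q+q)` by `ε_{Q+p} = −ε_p`),
multiplier `1/(U − 2μ₋)` (pole order ZERO: gapped mode), and Parseval for the bond fields `B_e`. No reflection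
positivity, no expansion, every `(U, δ)`. [cite: Yang1989, eq. (6)] -/
theorem etaWindowBound (U δ : ℝ) (hL : Even L) (ψ : Fock (Orb (FermionTorus 2 L)))
    (hψ1 : star ψ ⬝ᵥ ψ = 1)
    (hgs : IsGroundStateInSector (hubbardTorus 2 L 1 U) (2 * ⌊(1 - δ) * (L : ℝ) ^ 2 / 2⌋₊) 0 ψ)
    (hgap : (hubbardTorus 2 L 1 U).minEnergyOn
        (szSector (Λ := FermionTorus 2 L) (2 * ⌊(1 - δ) * (L : ℝ) ^ 2 / 2⌋₊) 0) -
      (hubbardTorus 2 L 1 U).minEnergyOn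
        (szSector (Λ := FermionTorus 2 L) (2 * ⌊(1 - δ) * (L : ℝ) ^ 2 / 2⌋₊ - 2) 0) < U)
    (ε : ℝ) :
    (∑ q : TorusSite 2 L, if q ≠ 0 ∧ momentumNormSq L q ≤ ε ^ 2 then
        (star (etaAt L (piPiLabel L + q) *ᵥ ψ) ⬝ᵥ (etaAt L (piPiLabel L + q) *ᵥ ψ)).re / (L : ℝ) ^ 2
      else 0) ≤
      8 * ε ^ 2 * (L : ℝ) ^ 2 /
        (U - ((hubbardTorus 2 L 1 U).minEnergyOn
            (szSector (Λ := FermionTorus 2 L) (2 * ⌊(1 - δ) * (L : ℝ) ^ 2 / 2⌋₊) 0) -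
          (hubbardTorus 2 L 1 U).minEnergyOn
            (szSector (Λ := FermionTorus 2 L) (2 * ⌊(1 - δ) * (L : ℝ) ^ 2 / 2⌋₊ - 2) 0))) ^ 2 := by
  sorry

/-- **One-sided KKT with an approximate lowering eigenoperator** (the abstract LEVER of idea 2; pole order
ONE when `ω ∼ |q|`): for Hermitian `H`, any matrix `B`, any real `ω`, and an eigenvector `H ψ = E ψ` with `B ψ` in a
sector `K'` of bottom `E' = minEnergyOn H K'`:  `(ω − (E − E')) · ‖Bψ‖₂ ≤ ‖(H B − B H + ω B) ψ‖₂` — the eigenvector is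
almost annihilated by any operator that almost satisfies a lowering equation of motion across the two sector bottoms
(variational principle in `K'` + Cauchy–Schwarz; no positivity hypothesis on `ω` is needed). [folklore] -/
theorem eucNorm_mulVec_le_of_approxLowering {ι : Type*} [Fintype ι] [DecidableEq ι] {H : Matrix ι ι ℂ}
    (K' : Submodule ℂ (ι → ℂ)) (B : Matrix ι ι ℂ) {ψ : ι → ℂ} {E : ℝ} (ω : ℝ)
    (hHψ : H *ᵥ ψ = (E : ℂ) • ψ) (hB : B *ᵥ ψ ∈ K') :
    (ω - (E - H.minEnergyOn K')) * eucNorm (B *ᵥ ψ) ≤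
      eucNorm ((H * B - B * H + (ω : ℂ) • B) *ᵥ ψ) := by
  set v : ι → ℂ := B *ᵥ ψ with hv
  set w : ι → ℂ := (H * B - B * H + (ω : ℂ) • B) *ᵥ ψ with hw
  -- the remainder applied to `ψ` is `H v + (ω − E) v`
  have hw' : w = H *ᵥ v + ((ω - E : ℝ) : ℂ) • v := by
    simp only [hw, hv, add_mulVec, sub_mulVec, smul_mulVec, ← mulVec_mulVec, hHψ, mulVec_smul,
      Complex.ofReal_sub]
    rw [sub_smul]
    abel
  -- variational principle in `K'`
  have hvar : H.minEnergyOn K' * (star v ⬝ᵥ v).re ≤ (star v ⬝ᵥ H *ᵥ v).re :=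
    Theorems.minEnergyOn_mul_re_le H K' hB
  -- `re ⟨v, w⟩ ≥ (ω − (E − E')) ‖v‖²`
  have hre : (ω - (E - H.minEnergyOn K')) * eucNorm v ^ 2 ≤ (star v ⬝ᵥ w).re := by
    rw [hw', dotProduct_add, dotProduct_smul, Complex.add_re, smul_eq_mul, Complex.re_ofReal_mul,
      eucNorm_sq]
    nlinarith [hvar, EigenvalueContinuation.re_star_dotProduct_self_nonneg v]
  -- Cauchy–Schwarz
  have hcs : (star v ⬝ᵥ w).re ≤ eucNorm v * eucNorm w :=
    (Complex.re_le_norm _).trans (norm_star_dotProduct_le v w)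
  have hv0 : 0 ≤ eucNorm v := eucNorm_nonneg v
  have hw0 : 0 ≤ eucNorm w := eucNorm_nonneg w
  rcases hv0.eq_or_lt with h0 | hpos
  · rw [← h0, mul_zero]
    exact hw0
  · have : (ω - (E - H.minEnergyOn K')) * eucNorm v * eucNorm v ≤ eucNorm w * eucNorm v := by
      nlinarith [hre, hcs]
    exact le_of_mul_le_mul_right this hpos

end Summit.HubbardSuperconductivity.HubbardSuperconductivity.Cruxes.WindowInfraredBound.Ideator4

end
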